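import Summits.Ventures.Crystal3D.Theorems.StickyWulffConstantNoReconstructionGainCubicFrame
import Literature.Algebra.EuclideanLattices.FccBccLattices
import HarnessLib

/-!
# Slot geometry of the fcc kissing shell: the cubic frame as an inner-product dictionary, a STEEP
# slot for every direction, and TWO ADJACENT BLOCKED slots for every off-lattice unit direction

HONEST FRAMING. Part of the venture `Summits/Ventures/Crystal3D` (cell `crystal3d-full`), helper for the
crux `GenericWallFloor` (stmt-Ventures-19480) of `route-Ventures-StickyWulffConstant`, line `WallLedgerG`
(planner cf-p1 gen 16), rigid-bicrystal rung of the crux stub `stub_twoSlabAdhesion` (slot-ledger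
architecture, this seat's note RIGID-RUNG-ARCH attached to the item).  Pure geometry of the twelve unit
vectors ("slots") of `Λ₀ = fccStacking 1 √(2/3)`; nothing about packings.

* `inner_eq_half_cubic` — the cubic frame `A, B, C` of `…CubicFrame` (`2‖p‖² = A² + B² + C²`) polarised:
  `⟪p, q⟫ = ½ (A p · A q + B p · B q + C p · C q)`;  `eq_of_cubic_eq` — cubic coordinates determine the vector.
* `exists_slot_of_cubic` — every `(σ, τ, υ) ∈ ℤ³` with `σ² + τ² + υ² = 2` is the cubic coordinate vector of
  a slot `w ∈ Λ₀`, `‖w‖ = 1`, with `⟪w, q⟫ = ½ (σ A q + τ B q + υ C q)`.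
* `exists_steep_slot` — **for every unit `ν` some slot has `⟪w, ν⟫ ≥ √2/2`** (covering radius `45°` of the
  cuboctahedron; equality only at the cube axes).  In the ledger this is the class `u*` whose lines give the
  `+1·πρ²` of the crux: `√2 ⟪u*, ν⟫ ≥ 1`.
* `exists_two_adjacent_slots_near` — **every unit `d ∉ Λ₀` is at angular distance `< 60°` from two ADJACENT
  slots** (`⟪w₁, d⟫, ⟪w₂, d⟫ > ½`, `⟪w₁, w₂⟫ = ½`): a foreign ball touching a lattice ball blocks at least two
  of its slots, and the blocked set contains an edge of the cuboctahedron (kit j278739: min 2, always an edge).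

WHAT THIS IS NOT: any statement about the crux stub itself; rung F-C1 not moved.
-/

noncomputable section

namespace Summit.Ventures.Crystal3D.Theorems

open Summit.Ventures.Crystal3D
open Literature.MathematicalPhysics.StatisticalMechanics (barlowPos fccStacking constHagg haggLabel_const
  barlowPos_mem barlowPos_apply_zero barlowPos_apply_one barlowPos_apply_two)
open Literature.Algebra.EuclideanLattices (inner_fin_three)
open scoped InnerProductSpace

/-! ## The cubic frame as an inner-product dictionary -/

/-- **Polarised cubic frame**: `⟪p, q⟫ = ½ (A p A q + B p B q + C p C q)` for the three cubic linear forms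
`A p = p₀ + (√3/3) p₁ − √(2/3) p₂`, `B p = p₀ − (√3/3) p₁ + √(2/3) p₂`, `C p = (2√3/3) p₁ + √(2/3) p₂`. -/
theorem inner_eq_half_cubic (p q : EuclideanSpace ℝ (Fin 3)) :
    ⟪p, q⟫_ℝ = 1 / 2 *
      ((p 0 + Real.sqrt 3 / 3 * p 1 - Real.sqrt (2 / 3) * p 2) *
          (q 0 + Real.sqrt 3 / 3 * q 1 - Real.sqrt (2 / 3) * q 2) +
        (p 0 - Real.sqrt 3 / 3 * p 1 + Real.sqrt (2 / 3) * p 2) *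
          (q 0 - Real.sqrt 3 / 3 * q 1 + Real.sqrt (2 / 3) * q 2) +
        (2 * Real.sqrt 3 / 3 * p 1 + Real.sqrt (2 / 3) * p 2) *
          (2 * Real.sqrt 3 / 3 * q 1 + Real.sqrt (2 / 3) * q 2)) := by
  obtain ⟨h3, h23⟩ := sqrt_three_sq_and
  rw [inner_fin_three]
  linear_combination (-(1 : ℝ) / 3 * p 1 * q 1) * h3 - (3 / 2 * p 2 * q 2) * h23

/-- Cubic coordinates determine the vector. -/
theorem eq_of_cubic_eq (p q : EuclideanSpace ℝ (Fin 3))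
    (hA : p 0 + Real.sqrt 3 / 3 * p 1 - Real.sqrt (2 / 3) * p 2 =
      q 0 + Real.sqrt 3 / 3 * q 1 - Real.sqrt (2 / 3) * q 2)
    (hB : p 0 - Real.sqrt 3 / 3 * p 1 + Real.sqrt (2 / 3) * p 2 =
      q 0 - Real.sqrt 3 / 3 * q 1 + Real.sqrt (2 / 3) * q 2)
    (hC : 2 * Real.sqrt 3 / 3 * p 1 + Real.sqrt (2 / 3) * p 2 =
      2 * Real.sqrt 3 / 3 * q 1 + Real.sqrt (2 / 3) * q 2) : p = q := by
  have h := two_mul_norm_sq_eq_cubic (p - q)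
  simp only [PiLp.sub_apply] at h
  have e1 : (p 0 - q 0) + Real.sqrt 3 / 3 * (p 1 - q 1) - Real.sqrt (2 / 3) * (p 2 - q 2) = 0 := by
    linarith
  have e2 : (p 0 - q 0) - Real.sqrt 3 / 3 * (p 1 - q 1) + Real.sqrt (2 / 3) * (p 2 - q 2) = 0 := by
    linarith
  have e3 : 2 * Real.sqrt 3 / 3 * (p 1 - q 1) + Real.sqrt (2 / 3) * (p 2 - q 2) = 0 := by linarith
  rw [e1, e2, e3] at h
  have h0 : ‖p - q‖ ^ 2 = 0 := by linarith
  have : ‖p - q‖ = 0 := by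
    have := norm_nonneg (p - q); nlinarith
  exact sub_eq_zero.1 (norm_eq_zero.1 this)

/-- **Slots from cubic coordinates.**  Every integer triple `(σ, τ, υ)` with `σ² + τ² + υ² = 2` (twelve of
them: one coordinate `0`, the other two `±1`) is the cubic coordinate vector of a unit vector `w ∈ Λ₀`,
and `⟪w, q⟫ = ½ (σ A q + τ B q + υ C q)` for every `q`. -/
theorem exists_slot_of_cubic (σ τ υ : ℤ) (h2 : σ ^ 2 + τ ^ 2 + υ ^ 2 = 2) :
    ∃ w ∈ fccStacking 1 (Real.sqrt (2 / 3)), ‖w‖ = 1 ∧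
      (w 0 + Real.sqrt 3 / 3 * w 1 - Real.sqrt (2 / 3) * w 2 = σ ∧
        w 0 - Real.sqrt 3 / 3 * w 1 + Real.sqrt (2 / 3) * w 2 = τ ∧
        2 * Real.sqrt 3 / 3 * w 1 + Real.sqrt (2 / 3) * w 2 = υ) ∧
      ∀ q : EuclideanSpace ℝ (Fin 3), ⟪w, q⟫_ℝ = 1 / 2 *
        (σ * (q 0 + Real.sqrt 3 / 3 * q 1 - Real.sqrt (2 / 3) * q 2) +
          τ * (q 0 - Real.sqrt 3 / 3 * q 1 + Real.sqrt (2 / 3) * q 2) +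
          υ * (2 * Real.sqrt 3 / 3 * q 1 + Real.sqrt (2 / 3) * q 2)) := by
  -- parity: the three squares are `0` or `1` and two of them are `1`
  have hσb : -1 ≤ σ ∧ σ ≤ 1 := by constructor <;> nlinarith
  have hτb : -1 ≤ τ ∧ τ ≤ 1 := by constructor <;> nlinarith
  have hυb : -1 ≤ υ ∧ υ ≤ 1 := by constructor <;> nlinarith
  have heven : Even (σ + τ + υ) := by
    obtain ⟨h1, h2⟩ := hσb; obtain ⟨h3, h4⟩ := hτb; obtain ⟨h5, h6⟩ := hυb
    interval_cases σ <;> interval_cases τ <;> interval_cases υ <;> simp_all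
  obtain ⟨k, i, j, hij, hik, hjk⟩ := barlowPos_of_cubic σ τ υ heven
  obtain ⟨hA, hB, hC⟩ := cubic_barlowPos k i j
  have e1 : ((i : ℝ) + j) = σ := by exact_mod_cast hij
  have e2 : ((i : ℝ) + k) = τ := by exact_mod_cast hik
  have e3 : ((j : ℝ) + k) = υ := by exact_mod_cast hjk
  rw [e1] at hA; rw [e2] at hB; rw [e3] at hC
  refine ⟨barlowPos 1 (Real.sqrt (2 / 3)) constHagg k i j, barlowPos_mem _ _ _, ?_, ⟨hA, hB, hC⟩, ?_⟩
  · have h := two_mul_norm_sq_eq_cubic (barlowPos 1 (Real.sqrt (2 / 3)) constHagg k i j)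
    rw [hA, hB, hC] at h
    have hs : ((σ : ℝ)) ^ 2 + ((τ : ℝ)) ^ 2 + ((υ : ℝ)) ^ 2 = 2 := by exact_mod_cast h2
    have hn : ‖barlowPos 1 (Real.sqrt (2 / 3)) constHagg k i j‖ ^ 2 = 1 := by linarith
    have hnn := norm_nonneg (barlowPos 1 (Real.sqrt (2 / 3)) constHagg k i j)
    nlinarith
  · intro q
    rw [inner_eq_half_cubic, hA, hB, hC]

/-- A real number has a sign `s ∈ {1, −1}` (as an integer) with `s · x = |x|`. -/
theorem exists_sign_mul_eq_abs (x : ℝ) : ∃ s : ℤ, s ^ 2 = 1 ∧ (s : ℝ) * x = |x| := by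
  rcases le_total 0 x with h | h
  · exact ⟨1, by norm_num, by rw [abs_of_nonneg h]; simp⟩
  · exact ⟨-1, by norm_num, by rw [abs_of_nonpos h]; simp⟩

/-! ## A steep slot for every direction -/

/-- `√2 ≤ s + t` as soon as `s, t ≥ 0` and `(s + t)² ≥ 2`. -/
theorem sqrt_two_le_add {s t : ℝ} (hs : 0 ≤ s) (ht : 0 ≤ t) (hst : 2 ≤ (s + t) ^ 2) :
    Real.sqrt 2 ≤ s + t := by
  calc Real.sqrt 2 ≤ Real.sqrt ((s + t) ^ 2) := Real.sqrt_le_sqrt hst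
    _ = s + t := Real.sqrt_sq (by positivity)

/-- **Steep slot.**  For every unit vector `ν` there is a unit vector `w` of `Λ₀` (one of the twelve
slots) with `⟪w, ν⟫ ≥ √2/2`.  (Cubic coordinates `(a, b, c)` of `ν` have `a² + b² + c² = 2`; for the two
of largest modulus `(|a| + |b|)² ≥ a² + b² + 2c² ≥ 2`; take the slot `(sgn a, sgn b, 0)`.) -/
theorem exists_steep_slot (ν : EuclideanSpace ℝ (Fin 3)) (hν : ‖ν‖ = 1) :
    ∃ w ∈ fccStacking 1 (Real.sqrt (2 / 3)), ‖w‖ = 1 ∧ Real.sqrt 2 / 2 ≤ ⟪w, ν⟫_ℝ := by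
  set a : ℝ := ν 0 + Real.sqrt 3 / 3 * ν 1 - Real.sqrt (2 / 3) * ν 2 with ha
  set b : ℝ := ν 0 - Real.sqrt 3 / 3 * ν 1 + Real.sqrt (2 / 3) * ν 2 with hb
  set c : ℝ := 2 * Real.sqrt 3 / 3 * ν 1 + Real.sqrt (2 / 3) * ν 2 with hc
  have habc : a ^ 2 + b ^ 2 + c ^ 2 = 2 := by
    have h := two_mul_norm_sq_eq_cubic ν
    rw [hν, one_pow, mul_one] at h
    rw [ha, hb, hc]; linarith
  obtain ⟨sa, hsa2, hsa⟩ := exists_sign_mul_eq_abs a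
  obtain ⟨sb, hsb2, hsb⟩ := exists_sign_mul_eq_abs b
  obtain ⟨sc, hsc2, hsc⟩ := exists_sign_mul_eq_abs c
  have haa : |a| ^ 2 = a ^ 2 := sq_abs a
  have hbb : |b| ^ 2 = b ^ 2 := sq_abs b
  have hcc : |c| ^ 2 = c ^ 2 := sq_abs c
  have h0a := abs_nonneg a; have h0b := abs_nonneg b; have h0c := abs_nonneg c
  -- three cases: which coordinate has the smallest modulus
  have hcase : (|c| ≤ |a| ∧ |c| ≤ |b|) ∨ (|b| ≤ |a| ∧ |b| ≤ |c|) ∨ (|a| ≤ |b| ∧ |a| ≤ |c|) := by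
    rcases le_total |c| |a| with hca | hac
    · rcases le_total |c| |b| with hcb | hbc
      · exact Or.inl ⟨hca, hcb⟩
      · exact Or.inr (Or.inl ⟨hbc.trans hca, hbc⟩)
    · rcases le_total |a| |b| with hab | hba
      · exact Or.inr (Or.inr ⟨hab, hac⟩)
      · exact Or.inr (Or.inl ⟨hba, hba.trans hac⟩)
  rcases hcase with ⟨h1, h2⟩ | ⟨h1, h2⟩ | ⟨h1, h2⟩
  · -- slot `(sa, sb, 0)`
    have hsum : Real.sqrt 2 ≤ |a| + |b| :=
      sqrt_two_le_add h0a h0b (by nlinarith [mul_le_mul h1 h2 h0c h0a])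
    obtain ⟨w, hw, hw1, -, hwq⟩ := exists_slot_of_cubic sa sb 0 (by linear_combination hsa2 + hsb2)
    refine ⟨w, hw, hw1, ?_⟩
    rw [hwq ν, ← ha, ← hb, ← hc]
    have e : (sa : ℝ) * a + (sb : ℝ) * b + ((0 : ℤ) : ℝ) * c = |a| + |b| := by
      rw [hsa, hsb]; push_cast; ring
    linarith
  · -- slot `(sa, 0, sc)`
    have hsum : Real.sqrt 2 ≤ |a| + |c| :=
      sqrt_two_le_add h0a h0c (by nlinarith [mul_le_mul h1 h2 h0b h0a])
    obtain ⟨w, hw, hw1, -, hwq⟩ := exists_slot_of_cubic sa 0 sc (by linear_combination hsa2 + hsc2)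
    refine ⟨w, hw, hw1, ?_⟩
    rw [hwq ν, ← ha, ← hb, ← hc]
    have e : (sa : ℝ) * a + ((0 : ℤ) : ℝ) * b + (sc : ℝ) * c = |a| + |c| := by
      rw [hsa, hsc]; push_cast; ring
    linarith
  · -- slot `(0, sb, sc)`
    have hsum : Real.sqrt 2 ≤ |b| + |c| :=
      sqrt_two_le_add h0b h0c (by nlinarith [mul_le_mul h1 h2 h0a h0b])
    obtain ⟨w, hw, hw1, -, hwq⟩ := exists_slot_of_cubic 0 sb sc (by linear_combination hsb2 + hsc2)
    refine ⟨w, hw, hw1, ?_⟩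
    rw [hwq ν, ← ha, ← hb, ← hc]
    have e : ((0 : ℤ) : ℝ) * a + (sb : ℝ) * b + (sc : ℝ) * c = |b| + |c| := by
      rw [hsb, hsc]; push_cast; ring
    linarith

/-! ## Two adjacent blocked slots for every off-lattice unit direction -/

/-- Real core of the blocking lemma: with `x² + y² + z² = 2` and `|y|, |z| ≤ |x|`, either `|x| + |z| > 1`
or `(x, y, z) = (±1, ±1, 0)`. -/
theorem one_lt_abs_add_abs_or (x y z : ℝ) (h2 : x ^ 2 + y ^ 2 + z ^ 2 = 2) (hy : |y| ≤ |x|)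
    (hz : |z| ≤ |x|) : 1 < |x| + |z| ∨ (z = 0 ∧ x ^ 2 = 1 ∧ y ^ 2 = 1) := by
  by_cases h : 1 < |x| + |z|
  · exact Or.inl h
  · right
    push Not at h
    have hxx : |x| ^ 2 = x ^ 2 := sq_abs x
    have hyy : |y| ^ 2 = y ^ 2 := sq_abs y
    have hzz : |z| ^ 2 = z ^ 2 := sq_abs z
    have h0x := abs_nonneg x; have h0y := abs_nonneg y; have h0z := abs_nonneg z
    have hx1 : |x| ≤ 1 := by linarith
    -- `4|z| ≤ 3 z²` and `|z| ≤ 1` force `z = 0`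
    have h4 : 4 * |z| ≤ 3 * |z| ^ 2 := by
      nlinarith [mul_le_mul hy hy h0y h0x, mul_le_mul h h (by positivity) zero_le_one]
    have hz0 : |z| = 0 := by nlinarith [hz.trans hx1]
    have hz0' : z = 0 := abs_eq_zero.1 hz0
    refine ⟨hz0', ?_, ?_⟩
    · nlinarith [mul_le_mul hy hy h0y h0x]
    · nlinarith [mul_le_mul hy hy h0y h0x]

/-- From `t² = 1` and `s · t = |t|` (with `s² = 1`) conclude `t = s`. -/
theorem eq_cast_of_sign_mul (t : ℝ) (s : ℤ) (hs : ((s : ℝ)) ^ 2 = 1) (hst : (s : ℝ) * t = |t|)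
    (ht : t ^ 2 = 1) : t = s := by
  have h1 : |t| = 1 := by
    have h0 := abs_nonneg t
    have h2 : |t| ^ 2 = 1 := by rw [sq_abs]; exact ht
    nlinarith
  rw [h1] at hst
  linear_combination (s : ℝ) * hst - t * hs

/-- **Blocking lemma.**  A unit vector `d` which is NOT a site of `Λ₀` (equivalently not one of the
twelve slots) makes angle `< 60°` with two ADJACENT slots: there are unit `w₁, w₂ ∈ Λ₀` with
`⟪w₁, w₂⟫ = ½` and `⟪w₁, d⟫ > ½`, `⟪w₂, d⟫ > ½`.  So a ball touching the lattice ball at the origin from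
the off-lattice position `d` is at distance `< 1` from the two slot positions `w₁, w₂` (both must be
empty), and `{w₁, w₂}` is an edge of the cuboctahedron.  (Cubic coordinates `(x, y, z)` of `d`, `|x|`
largest: the slots `(sgn x, sgn y, 0)` and `(sgn x, 0, sgn z)`; `|x| + min(|y|,|z|) > 1` unless `d` is a slot.) -/
theorem exists_two_adjacent_slots_near (d : EuclideanSpace ℝ (Fin 3)) (hd : ‖d‖ = 1)
    (hns : d ∉ fccStacking 1 (Real.sqrt (2 / 3))) :
    ∃ w₁ ∈ fccStacking 1 (Real.sqrt (2 / 3)), ∃ w₂ ∈ fccStacking 1 (Real.sqrt (2 / 3)),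
      ‖w₁‖ = 1 ∧ ‖w₂‖ = 1 ∧ ⟪w₁, w₂⟫_ℝ = 1 / 2 ∧ 1 / 2 < ⟪w₁, d⟫_ℝ ∧ 1 / 2 < ⟪w₂, d⟫_ℝ := by
  set x : ℝ := d 0 + Real.sqrt 3 / 3 * d 1 - Real.sqrt (2 / 3) * d 2 with hx
  set y : ℝ := d 0 - Real.sqrt 3 / 3 * d 1 + Real.sqrt (2 / 3) * d 2 with hy
  set z : ℝ := 2 * Real.sqrt 3 / 3 * d 1 + Real.sqrt (2 / 3) * d 2 with hz
  have hxyz : x ^ 2 + y ^ 2 + z ^ 2 = 2 := by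
    have h := two_mul_norm_sq_eq_cubic d
    rw [hd, one_pow, mul_one] at h
    rw [hx, hy, hz]; linarith
  obtain ⟨sx, hsx2, hsx⟩ := exists_sign_mul_eq_abs x
  obtain ⟨sy, hsy2, hsy⟩ := exists_sign_mul_eq_abs y
  obtain ⟨sz, hsz2, hsz⟩ := exists_sign_mul_eq_abs z
  have hsxR : ((sx : ℝ)) ^ 2 = 1 := by exact_mod_cast hsx2
  have hsyR : ((sy : ℝ)) ^ 2 = 1 := by exact_mod_cast hsy2
  have hszR : ((sz : ℝ)) ^ 2 = 1 := by exact_mod_cast hsz2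
  -- which coordinate has the largest modulus
  have hcase : (|y| ≤ |x| ∧ |z| ≤ |x|) ∨ (|x| ≤ |y| ∧ |z| ≤ |y|) ∨ (|x| ≤ |z| ∧ |y| ≤ |z|) := by
    rcases le_total |y| |x| with hyx | hxy
    · rcases le_total |z| |x| with hzx | hxz
      · exact Or.inl ⟨hyx, hzx⟩
      · exact Or.inr (Or.inr ⟨hxz, hyx.trans hxz⟩)
    · rcases le_total |z| |y| with hzy | hyz
      · exact Or.inr (Or.inl ⟨hxy, hzy⟩)
      · exact Or.inr (Or.inr ⟨hxy.trans hyz, hyz⟩)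
  rcases hcase with ⟨h1, h2⟩ | ⟨h1, h2⟩ | ⟨h1, h2⟩
  · -- `|x|` largest: slots `(sx, sy, 0)` and `(sx, 0, sz)`
    obtain ⟨w₁, hw₁, hw₁n, ⟨hA₁, hB₁, hC₁⟩, hq₁⟩ := exists_slot_of_cubic sx sy 0 (by linear_combination hsx2 + hsy2)
    obtain ⟨w₂, hw₂, hw₂n, ⟨hA₂, hB₂, hC₂⟩, hq₂⟩ := exists_slot_of_cubic sx 0 sz (by linear_combination hsx2 + hsz2)
    refine ⟨w₁, hw₁, w₂, hw₂, hw₁n, hw₂n, ?_, ?_, ?_⟩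
    · rw [hq₁ w₂, hA₂, hB₂, hC₂]; push_cast; linear_combination (1 / 2 : ℝ) * hsxR
    · rw [hq₁ d, ← hx, ← hy, ← hz]
      rcases one_lt_abs_add_abs_or x z y (by linarith [hxyz]) h2 h1 with hgt | ⟨hy0, hx1, hz1⟩
      · have e : (sx : ℝ) * x + (sy : ℝ) * y + ((0 : ℤ) : ℝ) * z = |x| + |y| := by
          rw [hsx, hsy]; push_cast; ring
        linarith
      · exfalso; apply hns
        have ex : x = sx := eq_cast_of_sign_mul x sx hsxR hsx hx1
        have ez : z = sz := eq_cast_of_sign_mul z sz hszR hsz hz1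
        rw [eq_of_cubic_eq d w₂ (by rw [hA₂, ← hx, ex]) (by rw [hB₂, ← hy, hy0]; simp)
          (by rw [hC₂, ← hz, ez])]
        exact hw₂
    · rw [hq₂ d, ← hx, ← hy, ← hz]
      rcases one_lt_abs_add_abs_or x y z (by linarith [hxyz]) h1 h2 with hgt | ⟨hz0, hx1, hy1⟩
      · have e : (sx : ℝ) * x + ((0 : ℤ) : ℝ) * y + (sz : ℝ) * z = |x| + |z| := by
          rw [hsx, hsz]; push_cast; ring
        linarith
      · exfalso; apply hns
        have ex : x = sx := eq_cast_of_sign_mul x sx hsxR hsx hx1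
        have ey : y = sy := eq_cast_of_sign_mul y sy hsyR hsy hy1
        rw [eq_of_cubic_eq d w₁ (by rw [hA₁, ← hx, ex]) (by rw [hB₁, ← hy, ey])
          (by rw [hC₁, ← hz, hz0]; simp)]
        exact hw₁
  · -- `|y|` largest: slots `(sx, sy, 0)` and `(0, sy, sz)`
    obtain ⟨w₁, hw₁, hw₁n, ⟨hA₁, hB₁, hC₁⟩, hq₁⟩ := exists_slot_of_cubic sx sy 0 (by linear_combination hsx2 + hsy2)
    obtain ⟨w₂, hw₂, hw₂n, ⟨hA₂, hB₂, hC₂⟩, hq₂⟩ := exists_slot_of_cubic 0 sy sz (by linear_combination hsy2 + hsz2)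
    refine ⟨w₁, hw₁, w₂, hw₂, hw₁n, hw₂n, ?_, ?_, ?_⟩
    · rw [hq₁ w₂, hA₂, hB₂, hC₂]; push_cast; linear_combination (1 / 2 : ℝ) * hsyR
    · rw [hq₁ d, ← hx, ← hy, ← hz]
      rcases one_lt_abs_add_abs_or y z x (by linarith [hxyz]) h2 h1 with hgt | ⟨hx0, hy1, hz1⟩
      · have e : (sx : ℝ) * x + (sy : ℝ) * y + ((0 : ℤ) : ℝ) * z = |x| + |y| := by
          rw [hsx, hsy]; push_cast; ring
        linarith
      · exfalso; apply hns
        have ey : y = sy := eq_cast_of_sign_mul y sy hsyR hsy hy1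
        have ez : z = sz := eq_cast_of_sign_mul z sz hszR hsz hz1
        rw [eq_of_cubic_eq d w₂ (by rw [hA₂, ← hx, hx0]; simp) (by rw [hB₂, ← hy, ey])
          (by rw [hC₂, ← hz, ez])]
        exact hw₂
    · rw [hq₂ d, ← hx, ← hy, ← hz]
      rcases one_lt_abs_add_abs_or y x z (by linarith [hxyz]) h1 h2 with hgt | ⟨hz0, hy1, hx1⟩
      · have e : ((0 : ℤ) : ℝ) * x + (sy : ℝ) * y + (sz : ℝ) * z = |y| + |z| := by
          rw [hsy, hsz]; push_cast; ring
        linarith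
      · exfalso; apply hns
        have ey : y = sy := eq_cast_of_sign_mul y sy hsyR hsy hy1
        have ex : x = sx := eq_cast_of_sign_mul x sx hsxR hsx hx1
        rw [eq_of_cubic_eq d w₁ (by rw [hA₁, ← hx, ex]) (by rw [hB₁, ← hy, ey])
          (by rw [hC₁, ← hz, hz0]; simp)]
        exact hw₁
  · -- `|z|` largest: slots `(sx, 0, sz)` and `(0, sy, sz)`
    obtain ⟨w₁, hw₁, hw₁n, ⟨hA₁, hB₁, hC₁⟩, hq₁⟩ := exists_slot_of_cubic sx 0 sz (by linear_combination hsx2 + hsz2)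
    obtain ⟨w₂, hw₂, hw₂n, ⟨hA₂, hB₂, hC₂⟩, hq₂⟩ := exists_slot_of_cubic 0 sy sz (by linear_combination hsy2 + hsz2)
    refine ⟨w₁, hw₁, w₂, hw₂, hw₁n, hw₂n, ?_, ?_, ?_⟩
    · rw [hq₁ w₂, hA₂, hB₂, hC₂]; push_cast; linear_combination (1 / 2 : ℝ) * hszR
    · rw [hq₁ d, ← hx, ← hy, ← hz]
      rcases one_lt_abs_add_abs_or z y x (by linarith [hxyz]) h2 h1 with hgt | ⟨hx0, hz1, hy1⟩
      · have e : (sx : ℝ) * x + ((0 : ℤ) : ℝ) * y + (sz : ℝ) * z = |x| + |z| := by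
          rw [hsx, hsz]; push_cast; ring
        linarith
      · exfalso; apply hns
        have ez : z = sz := eq_cast_of_sign_mul z sz hszR hsz hz1
        have ey : y = sy := eq_cast_of_sign_mul y sy hsyR hsy hy1
        rw [eq_of_cubic_eq d w₂ (by rw [hA₂, ← hx, hx0]; simp) (by rw [hB₂, ← hy, ey])
          (by rw [hC₂, ← hz, ez])]
        exact hw₂
    · rw [hq₂ d, ← hx, ← hy, ← hz]
      rcases one_lt_abs_add_abs_or z x y (by linarith [hxyz]) h1 h2 with hgt | ⟨hy0, hz1, hx1⟩
      · have e : ((0 : ℤ) : ℝ) * x + (sy : ℝ) * y + (sz : ℝ) * z = |y| + |z| := by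
          rw [hsy, hsz]; push_cast; ring
        linarith
      · exfalso; apply hns
        have ez : z = sz := eq_cast_of_sign_mul z sz hszR hsz hz1
        have ex : x = sx := eq_cast_of_sign_mul x sx hsxR hsx hx1
        rw [eq_of_cubic_eq d w₁ (by rw [hA₁, ← hx, ex]) (by rw [hB₁, ← hy, hy0]; simp)
          (by rw [hC₁, ← hz, ez])]
        exact hw₁

end Summit.Ventures.Crystal3D.Theorems

end
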